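import Summits.NavierStokesRegularity.NavierStokesRegularity.Theorems.FilamentSkeletonRssDefectColumnGateSectionalMoments

/-!
# Route `FilamentSkeletonRss` · crux `TransverseReduction1AR` (stmt-NavierStokesRegularity-23611) · line `defect_column_gate_1AR` —
# THE QUADRUPOLE OF THE AXIAL VORTICITY HAS A BOUNDED AXIAL PRIMITIVE (kinematics; completes LEAD note L10)

Helper file (`--supports stmt-NavierStokesRegularity-23611 --as helper`; LEAD of 23611, lane ns-filament-21221-p1 g12), third of the kinematic series
(`…SectionFrame` p670750, `…SectionalMoments` p671153).  `…SectionalMoments` showed that in the 3D class of stub S2a-loc `WaistColumnGateLoc1A` the sectional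
QUADRUPOLE of the axial vorticity `ω_d` is, for solenoidal `W`, a second moment of the AXIAL DERIVATIVE of the axial velocity
(`sectional_quadrupole_xxyy_eq_axial`: `ε∫(ξ₀²−ξ₁²)ω_d = −2∫ξ₀ξ₁⟨d, DW(y) d⟩`), so that — unlike for axially constant horizontal fields (p664511) — it need NOT vanish.
THIS FILE proves the complementary positive statement: it is the `τ`-DERIVATIVE of a bounded `W_d`-moment.

* `fderiv_eq_zero_of_support` — outside the closed sectional cylinder `DW = 0`;
* `hasDerivAt_secPt_axial` — `∂_τ secPt d m n τ ξ = d`;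
* `exists_bound_fderiv_slab`, `axialDeriv_integrand_le`, `integrable_discIndicator_mul` — the domination on an axial window;
* **`hasDerivAt_axialMoment`** — `d/dτ ∫ p(ξ)⟨d, W(secPt τ ξ)⟩dξ = ∫ p(ξ)⟨d, DW(secPt τ ξ) d⟩dξ` for continuous `p` and `C¹` fields vanishing outside the cylinder
  (dominated differentiation under the integral sign); `continuous_axialDerivMoment`;
* **`integral_sectional_quadrupole_xxyy_eq`** — `∫_{τ₁}^{τ₂} ε(∫(ξ₀²−ξ₁²)ω_d dξ)dτ = −2(P(τ₂) − P(τ₁))`, `P(τ) = ∫ξ₀ξ₁⟨d, W(secPt τ ξ)⟩dξ`: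
  over any axial window the integrated quadrupole is a difference of two `W_d`-moments, each bounded by `sup|W|·∫_{|ξ|≤|R|}|ξ₀ξ₁|` — the «bounded axial
  primitive» that the proof of S2a-loc must use in place of multipole vanishing (briefs v6.1 L10; the streak `W_d` is what carries it).

HONEST FRAMING: elementary identities about the KINEMATIC class of ONE linear MODEL operator of a hypothetical blow-up route (MODEL rung, negative side); no stub is
proved or refuted; `TransverseReduction1AR` open; nothing here bears on Navier–Stokes regularity.
-/

set_option linter.dupNamespace false

noncomputable section

namespace Summit.NavierStokesRegularity.NavierStokesRegularity.Theorems.DefectColumnGate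

open scoped BigOperators InnerProductSpace
open MeasureTheory Set Function
open Literature.Analysis.FluidPDE

section Primitive

variable {d m n : EuclideanSpace ℝ (Fin 3)} {W : EuclideanSpace ℝ (Fin 3) → EuclideanSpace ℝ (Fin 3)} {R : ℝ}

/-- Outside the closed sectional cylinder the field vanishes identically, hence so does its derivative. -/
theorem fderiv_eq_zero_of_support (hon : Orthonormal ℝ ![d, m, n]) (hsupp : ∀ y, R ^ 2 ≤ ‖y‖ ^ 2 - ⟪y, d⟫_ℝ ^ 2 → W y = 0)
    (τ : ℝ) {ξ : EuclideanSpace ℝ (Fin 2)} (hξ : |R| < ‖ξ‖) : fderiv ℝ W (secPt d m n τ ξ) = 0 := by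
  -- `W` agrees with `0` on the open set `{y | R² < |y|² − ⟨y,d⟩²}`, which contains `secPt d m n τ ξ`
  have hopen : IsOpen {y : EuclideanSpace ℝ (Fin 3) | R ^ 2 < ‖y‖ ^ 2 - ⟪y, d⟫_ℝ ^ 2} :=
    isOpen_lt continuous_const ((continuous_norm.pow 2).sub ((continuous_id.inner continuous_const).pow 2))
  have hmem : secPt d m n τ ξ ∈ {y : EuclideanSpace ℝ (Fin 3) | R ^ 2 < ‖y‖ ^ 2 - ⟪y, d⟫_ℝ ^ 2} := by
    show R ^ 2 < ‖secPt d m n τ ξ‖ ^ 2 - ⟪secPt d m n τ ξ, d⟫_ℝ ^ 2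
    rw [(secWt_secPt hon τ ξ).2, ← sq_abs R]
    exact pow_lt_pow_left₀ hξ (abs_nonneg R) two_ne_zero
  have hev : W =ᶠ[nhds (secPt d m n τ ξ)] fun _ => 0 :=
    Filter.eventually_of_mem (hopen.mem_nhds hmem) fun y hy => hsupp y (le_of_lt hy)
  rw [hev.fderiv_eq]
  exact fderiv_const_apply 0

/-- The section map is differentiable in the AXIAL variable with derivative `d`. -/
theorem hasDerivAt_secPt_axial (d m n : EuclideanSpace ℝ (Fin 3)) (ξ : EuclideanSpace ℝ (Fin 2)) (τ : ℝ) :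
    HasDerivAt (fun τ : ℝ => secPt d m n τ ξ) d τ := by
  have h : HasDerivAt (fun τ : ℝ => τ • d + (ξ 0 • m + ξ 1 • n)) ((1 : ℝ) • d + 0) τ :=
    ((hasDerivAt_id τ).smul_const d).add (hasDerivAt_const τ _)
  have he : (fun τ : ℝ => secPt d m n τ ξ) = fun τ => τ • d + (ξ 0 • m + ξ 1 • n) := by
    funext τ; simp only [secPt, add_assoc]
  rw [he]
  simpa using h

/-- A uniform bound for `‖DW‖` along the sections over a compact axial window (`W ∈ C¹`). -/
theorem exists_bound_fderiv_slab (hW : ContDiff ℝ 1 W) (d m n : EuclideanSpace ℝ (Fin 3)) (a b ρ : ℝ) :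
    ∃ K : ℝ, 0 ≤ K ∧ ∀ τ ∈ Icc a b, ∀ ξ : EuclideanSpace ℝ (Fin 2), ‖ξ‖ ≤ ρ → ‖fderiv ℝ W (secPt d m n τ ξ)‖ ≤ K := by
  have hDWc : Continuous (fderiv ℝ W) := hW.continuous_fderiv one_ne_zero
  have hScpt : IsCompact (Icc a b ×ˢ Metric.closedBall (0 : EuclideanSpace ℝ (Fin 2)) ρ) := isCompact_Icc.prod (isCompact_closedBall _ _)
  have hjc : Continuous fun q : ℝ × EuclideanSpace ℝ (Fin 2) => fderiv ℝ W (secPt d m n q.1 q.2) := by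
    refine hDWc.comp ?_
    have : (fun q : ℝ × EuclideanSpace ℝ (Fin 2) => secPt d m n q.1 q.2) = fun q => q.1 • d + ((q.2) 0 • m + (q.2) 1 • n) := by
      funext q; simp only [secPt, add_assoc]
    rw [this]; fun_prop
  obtain ⟨K, hK⟩ := hScpt.exists_bound_of_continuousOn hjc.continuousOn
  refine ⟨max K 0, le_max_right _ _, fun τ hτ ξ hξ => (hK (τ, ξ) ⟨hτ, by simpa using hξ⟩).trans (le_max_left _ _)⟩

/-- The dominated bound used twice below: on an axial window, `|p ξ ⟨d, DW(secPt τ ξ) d⟩|` is bounded by `|p ξ|·K` on the disc `|ξ| ≤ |R|` and vanishes outside. -/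
theorem axialDeriv_integrand_le (hon : Orthonormal ℝ ![d, m, n]) (hsupp : ∀ y, R ^ 2 ≤ ‖y‖ ^ 2 - ⟪y, d⟫_ℝ ^ 2 → W y = 0)
    {p : EuclideanSpace ℝ (Fin 2) → ℝ} {a b K : ℝ} (hK : ∀ τ ∈ Icc a b, ∀ ξ : EuclideanSpace ℝ (Fin 2), ‖ξ‖ ≤ |R| → ‖fderiv ℝ W (secPt d m n τ ξ)‖ ≤ K)
    {τ : ℝ} (hτ : τ ∈ Icc a b) (ξ : EuclideanSpace ℝ (Fin 2)) :
    ‖p ξ * ⟪d, fderiv ℝ W (secPt d m n τ ξ) d⟫_ℝ‖ ≤ (Metric.closedBall (0 : EuclideanSpace ℝ (Fin 2)) |R|).indicator (fun ξ => |p ξ| * K) ξ := by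
  have hd : ‖d‖ = 1 := by simpa using hon.1 0
  by_cases hξ : ‖ξ‖ ≤ |R|
  · have hin : ξ ∈ Metric.closedBall (0 : EuclideanSpace ℝ (Fin 2)) |R| := by simpa using hξ
    rw [Set.indicator_of_mem hin, Real.norm_eq_abs, abs_mul]
    refine mul_le_mul_of_nonneg_left ?_ (abs_nonneg _)
    calc |⟪d, fderiv ℝ W (secPt d m n τ ξ) d⟫_ℝ| ≤ ‖d‖ * ‖fderiv ℝ W (secPt d m n τ ξ) d‖ := abs_real_inner_le_norm _ _
      _ ≤ ‖d‖ * (‖fderiv ℝ W (secPt d m n τ ξ)‖ * ‖d‖) := by gcongr; exact ContinuousLinearMap.le_opNorm _ _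
      _ = ‖fderiv ℝ W (secPt d m n τ ξ)‖ := by rw [hd]; ring
      _ ≤ K := hK τ hτ ξ hξ
  · push Not at hξ
    rw [fderiv_eq_zero_of_support hon hsupp τ hξ]
    have hout : ξ ∉ Metric.closedBall (0 : EuclideanSpace ℝ (Fin 2)) |R| := by simpa using hξ
    rw [Set.indicator_of_notMem hout]
    simp

/-- The dominating function is integrable. -/
theorem integrable_discIndicator_mul {p : EuclideanSpace ℝ (Fin 2) → ℝ} (hp : Continuous p) (ρ K : ℝ) :
    Integrable ((Metric.closedBall (0 : EuclideanSpace ℝ (Fin 2)) ρ).indicator fun ξ => |p ξ| * K) :=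
  ((hp.abs.mul continuous_const).continuousOn.integrableOn_compact (isCompact_closedBall _ _)).integrable_indicator
    Metric.isClosed_closedBall.measurableSet

/-- **The axial derivative of a weighted `W_d`-moment is the weighted moment of `⟨d, DW d⟩`** (differentiation under the integral sign; `p` continuous,
`W ∈ C¹` vanishing outside the sectional cylinder): `d/dτ ∫ p(ξ) ⟨d, W(secPt τ ξ)⟩ dξ = ∫ p(ξ) ⟨d, DW(secPt τ ξ) d⟩ dξ`. -/
theorem hasDerivAt_axialMoment (hon : Orthonormal ℝ ![d, m, n]) (hW : ContDiff ℝ 1 W)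
    (hsupp : ∀ y, R ^ 2 ≤ ‖y‖ ^ 2 - ⟪y, d⟫_ℝ ^ 2 → W y = 0) {p : EuclideanSpace ℝ (Fin 2) → ℝ} (hp : Continuous p) (τ₀ : ℝ) :
    HasDerivAt (fun τ : ℝ => ∫ ξ : EuclideanSpace ℝ (Fin 2), p ξ * ⟪d, W (secPt d m n τ ξ)⟫_ℝ)
      (∫ ξ : EuclideanSpace ℝ (Fin 2), p ξ * ⟪d, fderiv ℝ W (secPt d m n τ₀ ξ) d⟫_ℝ) τ₀ := by
  have hWc : Continuous W := hW.continuous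
  have hDWc : Continuous (fderiv ℝ W) := hW.continuous_fderiv one_ne_zero
  have hsecc : ∀ τ : ℝ, Continuous fun ξ : EuclideanSpace ℝ (Fin 2) => secPt d m n τ ξ := fun τ => (contDiff_secPt d m n τ (k := 0)).continuous
  obtain ⟨K, -, hK⟩ := exists_bound_fderiv_slab hW d m n (τ₀ - 1) (τ₀ + 1) |R|
  -- pointwise derivative in `τ`
  have hderiv : ∀ ξ τ, HasDerivAt (fun τ : ℝ => p ξ * ⟪d, W (secPt d m n τ ξ)⟫_ℝ) (p ξ * ⟪d, fderiv ℝ W (secPt d m n τ ξ) d⟫_ℝ) τ := by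
    intro ξ τ
    have h1 : HasDerivAt (fun τ : ℝ => W (secPt d m n τ ξ)) (fderiv ℝ W (secPt d m n τ ξ) d) τ :=
      ((hW.differentiable one_ne_zero) (secPt d m n τ ξ)).hasFDerivAt.comp_hasDerivAt τ (hasDerivAt_secPt_axial d m n ξ τ)
    have h2 : HasDerivAt (fun τ : ℝ => ⟪d, W (secPt d m n τ ξ)⟫_ℝ) (⟪d, fderiv ℝ W (secPt d m n τ ξ) d⟫_ℝ) τ := by
      have h := (hasDerivAt_const τ d).inner ℝ h1
      simpa only [inner_zero_left, inner_zero_right, zero_add, add_zero] using h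
    exact h2.const_mul (p ξ)
  have hmeas : ∀ τ : ℝ, AEStronglyMeasurable (fun ξ : EuclideanSpace ℝ (Fin 2) => p ξ * ⟪d, W (secPt d m n τ ξ)⟫_ℝ) volume := fun τ =>
    (hp.mul (continuous_const.inner (hWc.comp (hsecc τ)))).aestronglyMeasurable
  have hmeas' : AEStronglyMeasurable (fun ξ : EuclideanSpace ℝ (Fin 2) => p ξ * ⟪d, fderiv ℝ W (secPt d m n τ₀ ξ) d⟫_ℝ) volume :=
    (hp.mul (continuous_const.inner ((hDWc.comp (hsecc τ₀)).clm_apply continuous_const))).aestronglyMeasurable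
  exact (hasDerivAt_integral_of_dominated_loc_of_deriv_le (s := Icc (τ₀ - 1) (τ₀ + 1))
    (F' := fun τ ξ => p ξ * ⟪d, fderiv ℝ W (secPt d m n τ ξ) d⟫_ℝ)
    (bound := (Metric.closedBall (0 : EuclideanSpace ℝ (Fin 2)) |R|).indicator fun ξ => |p ξ| * K)
    (Icc_mem_nhds (by linarith) (by linarith))
    (Filter.Eventually.of_forall hmeas) (integrable_mul_inner_comp_secPt hon hW hsupp d τ₀ hp) hmeas'
    (Filter.Eventually.of_forall fun ξ τ hτ => axialDeriv_integrand_le hon hsupp hK hτ ξ) (integrable_discIndicator_mul hp |R| K)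
    (Filter.Eventually.of_forall fun ξ τ _ => hderiv ξ τ)).2

/-- The weighted moment of `⟨d, DW d⟩` is continuous in the axial variable. -/
theorem continuous_axialDerivMoment (hon : Orthonormal ℝ ![d, m, n]) (hW : ContDiff ℝ 1 W)
    (hsupp : ∀ y, R ^ 2 ≤ ‖y‖ ^ 2 - ⟪y, d⟫_ℝ ^ 2 → W y = 0) {p : EuclideanSpace ℝ (Fin 2) → ℝ} (hp : Continuous p) :
    Continuous fun τ : ℝ => ∫ ξ : EuclideanSpace ℝ (Fin 2), p ξ * ⟪d, fderiv ℝ W (secPt d m n τ ξ) d⟫_ℝ := by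
  have hDWc : Continuous (fderiv ℝ W) := hW.continuous_fderiv one_ne_zero
  refine continuous_iff_continuousAt.2 fun a => ?_
  obtain ⟨K, -, hK⟩ := exists_bound_fderiv_slab hW d m n (a - 1) (a + 1) |R|
  have hjoint : Continuous fun q : ℝ × EuclideanSpace ℝ (Fin 2) => fderiv ℝ W (secPt d m n q.1 q.2) := by
    refine hDWc.comp ?_
    have : (fun q : ℝ × EuclideanSpace ℝ (Fin 2) => secPt d m n q.1 q.2) = fun q => q.1 • d + ((q.2) 0 • m + (q.2) 1 • n) := by
      funext q; simp only [secPt, add_assoc]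
    rw [this]; fun_prop
  have hcts : ContinuousOn (fun τ : ℝ => ∫ ξ : EuclideanSpace ℝ (Fin 2), p ξ * ⟪d, fderiv ℝ W (secPt d m n τ ξ) d⟫_ℝ) (Icc (a - 1) (a + 1)) := by
    refine continuousOn_of_dominated (bound := (Metric.closedBall (0 : EuclideanSpace ℝ (Fin 2)) |R|).indicator fun ξ => |p ξ| * K)
      (fun τ _ => (hp.mul (continuous_const.inner ((hDWc.comp ((contDiff_secPt d m n τ (k := 0)).continuous)).clm_apply
        continuous_const))).aestronglyMeasurable)
      (fun τ hτ => Filter.Eventually.of_forall fun ξ => axialDeriv_integrand_le hon hsupp hK hτ ξ) (integrable_discIndicator_mul hp |R| K)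
      (Filter.Eventually.of_forall fun ξ => ?_)
    exact (continuous_const.mul (continuous_const.inner ((hjoint.comp (continuous_id.prodMk continuous_const)).clm_apply
      continuous_const))).continuousOn
  exact hcts.continuousAt (Icc_mem_nhds (by linarith) (by linarith))

/-- **THE QUADRUPOLE OF THE AXIAL VORTICITY HAS A BOUNDED AXIAL PRIMITIVE** (solenoidal `W ∈ C¹` vanishing outside the cylinder): for `τ₁ ≤ τ₂`,
`∫_{τ₁}^{τ₂} ε (∫ (ξ₀² − ξ₁²) ω_d dξ) dτ = −2 (P(τ₂) − P(τ₁))` with `P(τ) = ∫ ξ₀ξ₁ ⟨d, W(secPt τ ξ)⟩ dξ` — a `W_d`-moment, bounded by the sup of `W` on the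
cylinder; the quadrupole itself need not vanish (LEAD note L10). -/
theorem integral_sectional_quadrupole_xxyy_eq (hon : Orthonormal ℝ ![d, m, n]) (hW : ContDiff ℝ 1 W) (hdiv : VectorCalculus.IsDivFree W)
    (hsupp : ∀ y, R ^ 2 ≤ ‖y‖ ^ 2 - ⟪y, d⟫_ℝ ^ 2 → W y = 0) (τ₁ τ₂ : ℝ) :
    ∫ τ in τ₁..τ₂, ⟪cross m n, d⟫_ℝ * ∫ ξ : EuclideanSpace ℝ (Fin 2), (ξ 0 ^ 2 - ξ 1 ^ 2) * ⟪curl W (secPt d m n τ ξ), d⟫_ℝ =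
      -(2 * ((∫ ξ : EuclideanSpace ℝ (Fin 2), ξ 0 * ξ 1 * ⟪d, W (secPt d m n τ₂ ξ)⟫_ℝ) -
        ∫ ξ : EuclideanSpace ℝ (Fin 2), ξ 0 * ξ 1 * ⟪d, W (secPt d m n τ₁ ξ)⟫_ℝ)) := by
  have hp : Continuous fun ξ : EuclideanSpace ℝ (Fin 2) => ξ 0 * ξ 1 :=
    (contDiff_coord 0 (k := 0)).continuous.mul (contDiff_coord 1 (k := 0)).continuous
  have hQ : ∀ τ, ⟪cross m n, d⟫_ℝ * ∫ ξ : EuclideanSpace ℝ (Fin 2), (ξ 0 ^ 2 - ξ 1 ^ 2) * ⟪curl W (secPt d m n τ ξ), d⟫_ℝ =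
      -(2 * ∫ ξ : EuclideanSpace ℝ (Fin 2), ξ 0 * ξ 1 * ⟪d, fderiv ℝ W (secPt d m n τ ξ) d⟫_ℝ) := fun τ =>
    sectional_quadrupole_xxyy_eq_axial hon hW hdiv hsupp τ
  simp_rw [hQ]
  have hderiv2 : ∀ τ ∈ uIcc τ₁ τ₂, HasDerivAt (fun τ : ℝ => -(2 * ∫ ξ : EuclideanSpace ℝ (Fin 2), ξ 0 * ξ 1 * ⟪d, W (secPt d m n τ ξ)⟫_ℝ))
      (-(2 * ∫ ξ : EuclideanSpace ℝ (Fin 2), ξ 0 * ξ 1 * ⟪d, fderiv ℝ W (secPt d m n τ ξ) d⟫_ℝ)) τ := fun τ _ =>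
    ((hasDerivAt_axialMoment hon hW hsupp hp τ).const_mul 2).neg
  have hcont : Continuous fun τ : ℝ => -(2 * ∫ ξ : EuclideanSpace ℝ (Fin 2), ξ 0 * ξ 1 * ⟪d, fderiv ℝ W (secPt d m n τ ξ) d⟫_ℝ) :=
    ((continuous_axialDerivMoment hon hW hsupp hp).const_mul (2:ℝ)).neg
  rw [intervalIntegral.integral_eq_sub_of_hasDerivAt hderiv2 (hcont.intervalIntegrable _ _)]
  ring

end Primitive

end Summit.NavierStokesRegularity.NavierStokesRegularity.Theorems.DefectColumnGate

end
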